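import Mathlib.Combinatorics.SimpleGraph.Coloring.Vertex
import Summits.Ventures.DiscreteObjects.UnitDistance.ValuationRingReduction
import Summits.Ventures.DiscreteObjects.UnitDistance.Zeta8Residues

/-!
# The 2-adic Hermitian reduction for `ℚ(√2, √3)` (cell `pub-namedobj`, target (U), seat udg g10)

Framing (verbatim for the cell): lottery ticket; floor = certified bounds/negative ranges.

Local core of U4 (`χ(ℚ(√2,√3)²) = 4`, udg g3 FIELD/Prop U2; kernel lower bound `FourChromaticSqrt2Sqrt3`): inside a field
`Ω ⊇ ℚ₂` with `LocalData23` (`I² = −1`, `s2² = 2`, `s3² = 3`; automorphisms `σ : I ↦ −I` fixing `s2, s3`,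
`τ : s3 ↦ −s3` fixing `I, s2`, `ρ : s2 ↦ −s2` fixing `I`), a UNIT STEP `u = X + I·Y` with
`X, Y ∈ ℚ₂ ⊕ ℚ₂ s2 ⊕ ℚ₂ s3 ⊕ ℚ₂ s2 s3` and `X² + Y² = 1` has `‖u‖ = 1` and residue a cube root of unity: `T = u + τu`
and `N = u·τu` lie in `ℚ₂(s2, i) = ℚ₂(ζ₈)`, whose unit-ball elements have residue `0` or `1` (`Zeta8Residues`).
A general colouring lemma `colorable_four_of_cube_steps` (any step set with these two properties) finishes as in U1.
Nothing here is literature.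
-/

noncomputable section

namespace Summit.Ventures.DiscreteObjects.UnitDistance.MoserLocal

open Spectral SimpleGraph

/-- Local data for `ℚ₂(√2, √3, i)`. -/
structure LocalData23 (Ω : Type*) [Field Ω] [Algebra ℚ_[2] Ω] where
  /-- a square root of `-1` -/
  I : Ω
  /-- a square root of `2` -/
  s2 : Ω
  /-- a square root of `3` -/
  s3 : Ω
  /-- `I² = -1` -/
  hI : I ^ 2 = -1
  /-- `s2² = 2` -/
  hs2 : s2 ^ 2 = 2
  /-- `s3² = 3` -/
  hs3 : s3 ^ 2 = 3
  /-- negates `I`, fixes `s2, s3` -/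
  σ : Ω ≃ₐ[ℚ_[2]] Ω
  /-- negates `s3`, fixes `I, s2` -/
  τ : Ω ≃ₐ[ℚ_[2]] Ω
  /-- negates `s2`, fixes `I` -/
  ρ : Ω ≃ₐ[ℚ_[2]] Ω
  /-- `σ I = -I` -/
  σI : σ I = -I
  /-- `σ s2 = s2` -/
  σs2 : σ s2 = s2
  /-- `σ s3 = s3` -/
  σs3 : σ s3 = s3
  /-- `τ I = I` -/
  τI : τ I = I
  /-- `τ s2 = s2` -/
  τs2 : τ s2 = s2
  /-- `τ s3 = -s3` -/
  τs3 : τ s3 = -s3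
  /-- `ρ I = I` -/
  ρI : ρ I = I
  /-- `ρ s2 = -s2` -/
  ρs2 : ρ s2 = -s2

variable {Ω : Type*} [Field Ω] [CharZero Ω] [Algebra ℚ_[2] Ω] [Algebra.IsAlgebraic ℚ_[2] Ω] (D : LocalData23 Ω)

/-- The `ℚ₂(√2, i)` part of the data. -/
def LocalData23.zeta8 : Zeta8Data Ω :=
  ⟨D.I, D.s2, D.hI, D.hs2, D.σ, D.ρ, D.σI, D.σs2, D.ρI, D.ρs2⟩

/-- Membership in `V₈ = ℚ₂ ⊕ ℚ₂ s2 ⊕ ℚ₂ I ⊕ ℚ₂ s2 I`, as represented by `Zeta8Data.ev`. -/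
def LocalData23.InV8 (x : Ω) : Prop := ∃ w : Fin 4 → ℚ_[2], x = D.zeta8.ev w

omit [CharZero Ω] [Algebra.IsAlgebraic ℚ_[2] Ω] in
/-- Unfolding `ev` for `D.zeta8`. -/
theorem LocalData23.ev_eq (w : Fin 4 → ℚ_[2]) : D.zeta8.ev w =
    algebraMap ℚ_[2] Ω (w 0) + algebraMap ℚ_[2] Ω (w 1) * D.s2 + algebraMap ℚ_[2] Ω (w 2) * D.I +
      algebraMap ℚ_[2] Ω (w 3) * (D.s2 * D.I) := rfl

omit [CharZero Ω] [Algebra.IsAlgebraic ℚ_[2] Ω] in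
/-- `a + b s2 ∈ V₈`. -/
theorem LocalData23.inV8_pair (a b : ℚ_[2]) : D.InV8 (algebraMap ℚ_[2] Ω a + algebraMap ℚ_[2] Ω b * D.s2) :=
  ⟨![a, b, 0, 0], by simp [LocalData23.ev_eq]⟩

omit [CharZero Ω] [Algebra.IsAlgebraic ℚ_[2] Ω] in
/-- `I ∈ V₈`. -/
theorem LocalData23.inV8_I : D.InV8 D.I := ⟨![0, 0, 1, 0], by simp [LocalData23.ev_eq]⟩

section closure
variable {D}

omit [CharZero Ω] [Algebra.IsAlgebraic ℚ_[2] Ω] in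
/-- `V₈` is closed under addition. -/
theorem LocalData23.InV8.add {x y : Ω} (hx : D.InV8 x) (hy : D.InV8 y) : D.InV8 (x + y) := by
  obtain ⟨w, rfl⟩ := hx; obtain ⟨w', rfl⟩ := hy
  exact ⟨w + w', (D.zeta8.ev_add w w').symm⟩

omit [CharZero Ω] [Algebra.IsAlgebraic ℚ_[2] Ω] in
/-- `V₈` is closed under subtraction. -/
theorem LocalData23.InV8.sub {x y : Ω} (hx : D.InV8 x) (hy : D.InV8 y) : D.InV8 (x - y) := by
  obtain ⟨w, rfl⟩ := hx; obtain ⟨w', rfl⟩ := hy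
  refine ⟨w - w', ?_⟩
  simp only [LocalData23.ev_eq, Pi.sub_apply, map_sub]; ring

omit [CharZero Ω] [Algebra.IsAlgebraic ℚ_[2] Ω] in
/-- `V₈` is closed under multiplication (it is the algebra `ℚ₂[s2, I]`). -/
theorem LocalData23.InV8.mul {x y : Ω} (hx : D.InV8 x) (hy : D.InV8 y) : D.InV8 (x * y) := by
  obtain ⟨w, rfl⟩ := hx; obtain ⟨v, rfl⟩ := hy
  refine ⟨![w 0 * v 0 + 2 * w 1 * v 1 - w 2 * v 2 - 2 * w 3 * v 3,
    w 0 * v 1 + w 1 * v 0 - w 2 * v 3 - w 3 * v 2,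
    w 0 * v 2 + 2 * w 1 * v 3 + w 2 * v 0 + 2 * w 3 * v 1,
    w 0 * v 3 + w 1 * v 2 + w 2 * v 1 + w 3 * v 0], ?_⟩
  simp only [LocalData23.ev_eq, Matrix.cons_val_zero, Matrix.cons_val_one, Matrix.cons_val, map_add, map_sub,
    map_mul, map_ofNat]
  set A := algebraMap ℚ_[2] Ω (w 0); set B := algebraMap ℚ_[2] Ω (w 1); set C := algebraMap ℚ_[2] Ω (w 2)
  set E := algebraMap ℚ_[2] Ω (w 3); set A' := algebraMap ℚ_[2] Ω (v 0); set B' := algebraMap ℚ_[2] Ω (v 1)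
  set C' := algebraMap ℚ_[2] Ω (v 2); set E' := algebraMap ℚ_[2] Ω (v 3)
  linear_combination (B * B' + B * E' * D.I + E * B' * D.I + E * E' * D.I ^ 2) * D.hs2 +
    (C * C' + C * E' * D.s2 + E * C' * D.s2 + 2 * E * E') * D.hI

/-- Residues of unit-ball elements of `V₈` are `0` or `1` (`Zeta8Residues`). -/
theorem LocalData23.InV8.resid_zero_or_one {x : Ω} (hx : D.InV8 x) (hb : x ∈ ball ℚ_[2] Ω) :
    resid ℚ_[2] Ω ⟨x, hb⟩ = 0 ∨ resid ℚ_[2] Ω ⟨x, hb⟩ = 1 := by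
  obtain ⟨w, rfl⟩ := hx
  exact D.zeta8.resid_zero_or_one w hb

end closure

/-! ## Unit steps over `ℚ₂(√2, √3)` -/

/-- UNIT STEPS for `ℚ(√2,√3)`: `u = (A + B s3) + I (C + E s3)` with `A, B, C, E ∈ ℚ₂ ⊕ ℚ₂ s2` and
`(A + B s3)² + (C + E s3)² = 1`. -/
def unitSteps23 : Set Ω :=
  {u | ∃ a b c d e f g h : ℚ_[2],
    u = ((algebraMap ℚ_[2] Ω a + algebraMap ℚ_[2] Ω b * D.s2) + (algebraMap ℚ_[2] Ω c + algebraMap ℚ_[2] Ω d * D.s2) * D.s3)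
      + D.I * ((algebraMap ℚ_[2] Ω e + algebraMap ℚ_[2] Ω f * D.s2) + (algebraMap ℚ_[2] Ω g + algebraMap ℚ_[2] Ω h * D.s2) * D.s3) ∧
    ((algebraMap ℚ_[2] Ω a + algebraMap ℚ_[2] Ω b * D.s2) + (algebraMap ℚ_[2] Ω c + algebraMap ℚ_[2] Ω d * D.s2) * D.s3) ^ 2 +
      ((algebraMap ℚ_[2] Ω e + algebraMap ℚ_[2] Ω f * D.s2) + (algebraMap ℚ_[2] Ω g + algebraMap ℚ_[2] Ω h * D.s2) * D.s3) ^ 2 = 1}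

omit [CharZero Ω] [Algebra.IsAlgebraic ℚ_[2] Ω] in
/-- `σ` fixes `a + b s2`. -/
theorem LocalData23.σ_pair (a b : ℚ_[2]) :
    D.σ (algebraMap ℚ_[2] Ω a + algebraMap ℚ_[2] Ω b * D.s2) = algebraMap ℚ_[2] Ω a + algebraMap ℚ_[2] Ω b * D.s2 := by
  rw [map_add, map_mul, D.σ.commutes, D.σ.commutes, D.σs2]

omit [CharZero Ω] [Algebra.IsAlgebraic ℚ_[2] Ω] in
/-- `τ` fixes `a + b s2`. -/
theorem LocalData23.τ_pair (a b : ℚ_[2]) :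
    D.τ (algebraMap ℚ_[2] Ω a + algebraMap ℚ_[2] Ω b * D.s2) = algebraMap ℚ_[2] Ω a + algebraMap ℚ_[2] Ω b * D.s2 := by
  rw [map_add, map_mul, D.τ.commutes, D.τ.commutes, D.τs2]

/-- A unit step has norm `1` (`u·σu = 1`, Galois invariance). -/
theorem spN_unitStep23 {u : Ω} (hu : u ∈ unitSteps23 D) : spN ℚ_[2] u = 1 := by
  obtain ⟨a, b, c, d, e, f, g, h, rfl, hq⟩ := hu
  set A := algebraMap ℚ_[2] Ω a + algebraMap ℚ_[2] Ω b * D.s2 with hA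
  set B := algebraMap ℚ_[2] Ω c + algebraMap ℚ_[2] Ω d * D.s2 with hB
  set C := algebraMap ℚ_[2] Ω e + algebraMap ℚ_[2] Ω f * D.s2 with hC
  set E := algebraMap ℚ_[2] Ω g + algebraMap ℚ_[2] Ω h * D.s2 with hE
  have hσ : D.σ ((A + B * D.s3) + D.I * (C + E * D.s3)) = (A + B * D.s3) - D.I * (C + E * D.s3) := by
    simp only [hA, hB, hC, hE, map_add, map_mul, AlgEquiv.commutes, D.σI, D.σs2, D.σs3]; ring
  have hprod : ((A + B * D.s3) + D.I * (C + E * D.s3)) * D.σ ((A + B * D.s3) + D.I * (C + E * D.s3)) = 1 := by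
    rw [hσ]; linear_combination hq + (-((C + E * D.s3) ^ 2)) * D.hI
  have hn := congrArg (spN ℚ_[2]) hprod
  rw [spN_mul, spN_aut, spN_one] at hn
  have h0 := spN_nonneg ℚ_[2] ((A + B * D.s3) + D.I * (C + E * D.s3))
  nlinarith [hn, h0]

/-- A unit step lies in the unit ball. -/
theorem unitStep23_mem_ball {u : Ω} (hu : u ∈ unitSteps23 D) : u ∈ ball ℚ_[2] Ω := by
  rw [mem_ball_iff, spN_unitStep23 D hu]

/-- MAIN LOCAL LEMMA for `ℚ(√2,√3)`: the residue of a unit step is a cube root of unity. -/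
theorem resid_unitStep23_cube {u : Ω} (hu : u ∈ unitSteps23 D) :
    resid ℚ_[2] Ω ⟨u, unitStep23_mem_ball D hu⟩ ^ 3 = 1 := by
  have hmem := unitStep23_mem_ball D hu
  have hnu := spN_unitStep23 D hu
  obtain ⟨a, b, c, d, e, f, g, h, hu_eq, hq⟩ := hu
  set A := algebraMap ℚ_[2] Ω a + algebraMap ℚ_[2] Ω b * D.s2 with hA
  set B := algebraMap ℚ_[2] Ω c + algebraMap ℚ_[2] Ω d * D.s2 with hB
  set C := algebraMap ℚ_[2] Ω e + algebraMap ℚ_[2] Ω f * D.s2 with hC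
  set E := algebraMap ℚ_[2] Ω g + algebraMap ℚ_[2] Ω h * D.s2 with hE
  have hAv : D.InV8 A := D.inV8_pair a b
  have hBv : D.InV8 B := D.inV8_pair c d
  have hCv : D.InV8 C := D.inV8_pair e f
  have hEv : D.InV8 E := D.inV8_pair g h
  -- τ u
  have hτu : D.τ u = (A - B * D.s3) + D.I * (C - E * D.s3) := by
    rw [hu_eq]
    simp only [hA, hB, hC, hE, map_add, map_mul, AlgEquiv.commutes, D.τI, D.τs2, D.τs3]; ring
  set T : Ω := u + D.τ u with hT
  set N : Ω := u * D.τ u with hN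
  have hT_eq : T = (A + A) + D.I * (C + C) := by rw [hT, hτu, hu_eq]; ring
  have hN_eq : N = (A * A - 3 * (B * B)) + D.I * ((A * C + A * C) - 3 * (B * E + B * E)) +
      D.I * D.I * (C * C - 3 * (E * E)) := by
    rw [hN, hτu, hu_eq]; linear_combination (-(B ^ 2) - 2 * D.I * B * E - D.I ^ 2 * E ^ 2) * D.hs3
  have h3v : D.InV8 (3 : Ω) := by
    have h := D.inV8_pair 3 0
    rwa [map_ofNat, map_zero, zero_mul, add_zero] at h
  have hTv : D.InV8 T := by rw [hT_eq]; exact (hAv.add hAv).add (D.inV8_I.mul (hCv.add hCv))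
  have hNv : D.InV8 N := by
    rw [hN_eq]
    exact (((hAv.mul hAv).sub (h3v.mul (hBv.mul hBv))).add
      (D.inV8_I.mul (((hAv.mul hCv).add (hAv.mul hCv)).sub (h3v.mul ((hBv.mul hEv).add (hBv.mul hEv)))))).add
      ((D.inV8_I.mul D.inV8_I).mul ((hCv.mul hCv).sub (h3v.mul (hEv.mul hEv))))
  have hnτ : spN ℚ_[2] (D.τ u) = 1 := by rw [spN_aut]; exact hnu
  have hT_le : spN ℚ_[2] T ≤ 1 := by rw [hT]; exact (spN_add_le ℚ_[2] _ _).trans (max_le hnu.le hnτ.le)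
  have hN_one : spN ℚ_[2] N = 1 := by rw [hN, spN_mul, hnu, hnτ, mul_one]
  have hTmem : T ∈ ball ℚ_[2] Ω := hT_le
  have hNmem : N ∈ ball ℚ_[2] Ω := by rw [mem_ball_iff, hN_one]
  set ub : ball ℚ_[2] Ω := ⟨u, hmem⟩ with hub
  set Tb : ball ℚ_[2] Ω := ⟨T, hTmem⟩ with hTb
  set Nb : ball ℚ_[2] Ω := ⟨N, hNmem⟩ with hNb
  have hrel : ub ^ 2 - Tb * ub + Nb = 0 := by
    apply Subtype.ext
    change u ^ 2 - T * u + N = (0 : Ω)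
    rw [hT, hN]; ring
  have hT01 := hTv.resid_zero_or_one hTmem
  have hN01 := hNv.resid_zero_or_one hNmem
  have hN_ne : resid ℚ_[2] Ω Nb ≠ 0 := resid_ne_zero_of_spN_eq_one ℚ_[2] hN_one
  have hN1 : resid ℚ_[2] Ω Nb = 1 := by
    rcases hN01 with h0 | h1
    · exact absurd h0 hN_ne
    · exact h1
  have key := congrArg (resid ℚ_[2] Ω) hrel
  rw [map_add, map_sub, map_mul, map_pow, map_zero, hN1] at key
  set x := resid ℚ_[2] Ω ub with hx
  rcases hT01 with h0 | h1
  · rw [h0, zero_mul, sub_zero] at key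
    have hsq : (x + 1) ^ 2 = 0 := by
      have : (x + 1) ^ 2 = x ^ 2 + 1 + 2 * x := by ring
      rw [this, key, two_eq_zero_resid, zero_mul, add_zero]
    have hx1 : x + 1 = 0 := pow_eq_zero_iff (by norm_num) |>.1 hsq
    have hx' : x = 1 := by
      have := eq_neg_of_add_eq_zero_left hx1
      rw [this, neg_eq_self_resid]
    rw [hx', one_pow]
  · rw [h1, one_mul] at key
    have h3 : x ^ 3 + 1 = (x + 1) * (x ^ 2 - x + 1) := by ring
    rw [key, mul_zero] at h3
    rw [eq_neg_of_add_eq_zero_left h3, neg_eq_self_resid]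

/-! ## A general colouring lemma: step sets with unit norm and cube residues -/

omit [CharZero Ω] in
/-- GENERAL FORM of `colorable_four_of_unitStep_labels`: if every edge difference of the labelling `z` lies in a set
`S` of norm-one elements whose residues are cube roots of unity, the graph is `4`-colourable. -/
theorem colorable_four_of_cube_steps (S : Set Ω) (hS1 : ∀ u ∈ S, spN ℚ_[2] u = 1)
    (hS3 : ∀ u (hu : u ∈ S), resid ℚ_[2] Ω ⟨u, by rw [mem_ball_iff, hS1 u hu]⟩ ^ 3 = 1)
    {V : Type*} {G : SimpleGraph V} (z : V → Ω) (hz : ∀ ⦃v w : V⦄, G.Adj v w → z v - z w ∈ S) :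
    G.Colorable 4 := by
  classical
  -- along walks: differences in the ball with residues in `quartFixed`
  have hwalk : ∀ {x y : V} (p : G.Walk x y),
      ∃ h : z y - z x ∈ ball ℚ_[2] Ω, resid ℚ_[2] Ω ⟨z y - z x, h⟩ ∈ quartFixed Ω := by
    intro x y p
    induction p with
    | @nil x =>
      have h0 : z x - z x ∈ ball ℚ_[2] Ω := by rw [sub_self]; exact (ball ℚ_[2] Ω).zero_mem
      refine ⟨h0, ?_⟩
      have : (⟨z x - z x, h0⟩ : ball ℚ_[2] Ω) = 0 := Subtype.ext (sub_self _)
      rw [this, map_zero]; exact zero_mem_quartFixed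
    | @cons a b c hab p ih =>
      obtain ⟨hbc, hcol⟩ := ih
      have hu : z b - z a ∈ S := hz (G.adj_symm hab)
      have hub : z b - z a ∈ ball ℚ_[2] Ω := by rw [mem_ball_iff, hS1 _ hu]
      have hsum : z c - z a = (z c - z b) + (z b - z a) := by ring
      have hmem : z c - z a ∈ ball ℚ_[2] Ω := by rw [hsum]; exact (ball ℚ_[2] Ω).add_mem hbc hub
      refine ⟨hmem, ?_⟩
      have : (⟨z c - z a, hmem⟩ : ball ℚ_[2] Ω) = ⟨z c - z b, hbc⟩ + ⟨z b - z a, hub⟩ := Subtype.ext hsum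
      rw [this, map_add]
      exact add_mem_quartFixed hcol (mem_quartFixed_of_cube (hS3 _ hu))
  have hbase : ∀ v, ∃ h : z v - z (baseVertex G v) ∈ ball ℚ_[2] Ω,
      resid ℚ_[2] Ω ⟨z v - z (baseVertex G v), h⟩ ∈ quartFixed Ω := fun v => by
    obtain ⟨p⟩ := baseVertex_reachable G v
    exact hwalk p
  obtain ⟨F, hF4, hF⟩ := exists_finset_quartFixed (Ω := Ω)
  let c : V → F := fun v => ⟨resid ℚ_[2] Ω ⟨z v - z (baseVertex G v), (hbase v).1⟩, hF _ (hbase v).2⟩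
  have hvalid : ∀ {v w : V}, G.Adj v w → c v ≠ c w := by
    intro v w hvw hcvw
    have hb : baseVertex G w = baseVertex G v := (baseVertex_eq_of_adj hvw).symm
    have heq : resid ℚ_[2] Ω ⟨z v - z (baseVertex G v), (hbase v).1⟩ =
        resid ℚ_[2] Ω ⟨z w - z (baseVertex G w), (hbase w).1⟩ := congrArg Subtype.val hcvw
    rw [resid_eq_iff] at heq
    have hdiff : (z v - z (baseVertex G v)) - (z w - z (baseVertex G w)) = z v - z w := by rw [hb]; ring
    have hlt : spN ℚ_[2] (z v - z w) < 1 := by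
      have := heq
      simp only at this
      rwa [hdiff] at this
    rw [hS1 _ (hz hvw)] at hlt
    exact lt_irrefl _ hlt
  exact (Coloring.mk c hvalid).colorable.mono (by simpa using hF4)

/-- U4 local form: labels with `unitSteps23` differences give a `4`-colourable graph. -/
theorem colorable_four_of_unitStep23_labels {V : Type*} {G : SimpleGraph V} (z : V → Ω)
    (hz : ∀ ⦃v w : V⦄, G.Adj v w → z v - z w ∈ unitSteps23 D) : G.Colorable 4 :=
  colorable_four_of_cube_steps (unitSteps23 D) (fun _ hu => spN_unitStep23 D hu)
    (fun _ hu => resid_unitStep23_cube D hu) z hz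

end Summit.Ventures.DiscreteObjects.UnitDistance.MoserLocal
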